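import Summits.AtomisticToContinuum.Crystallization.Theorems.PhononSlackCertificatesPeriodicGivenLayeredRegistry
import Summits.AtomisticToContinuum.Crystallization.Theorems.PhononSlackCertificatesPeriodicGivenLayeredLayerCake1
import Literature.MathematicalPhysics.StatisticalMechanics.BarlowStackingEnergy

/-!
# `StackingHinge` (stmt-AtomisticToContinuum-14993), line `Sketch`: stub `stub_J2neg`

The sign conjunct (with a uniform margin) of item 3063 `PoissonBesselStacking.LjRegistryDomination`:
on the box `B = {47/50 ≤ a ≤ 1, 39/50·a ≤ h ≤ 17/20·a}` the second interlayer registry coupling of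
the Lennard-Jones potential, `J₂(a, h) = barlowCoupling lennardJones a h 2`, satisfies `J₂ ≤ -c₀` for
a constant `c₀ > 0` independent of `(a, h)`.

Proof. The reindexing `barlowCoupling V a h 2 = barlowCoupling V a (2h) 1` (a layer at distance `2`
and spacing `h` is a layer at distance `1` and spacing `2h`: `‖layerVec a h δ 2 i j‖ =
‖layerVec a (2h) δ 1 i j‖`) reduces the claim to the registry coupling
`D_a(H) = barlowCoupling lennardJones a H 1` at `H = 2h ∈ [39a/25, 17a/10]`.  By
`LayeredHull.stub_registry`, `D_a` is `≤ 0` and non-decreasing on `H ≥ 39a/25` and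
`D_a(117a/50) - D_a(17a/10) ≥ c₀`, whence
`J₂(a, h) = D_a(2h) ≤ D_a(17a/10) ≤ D_a(117a/50) - c₀ ≤ -c₀`.
-/

noncomputable section

namespace Summit.AtomisticToContinuum.Crystallization.Theorems.PricedHcpWindowsJ2Neg

open Literature.MathematicalPhysics.StatisticalMechanics

/-! ## Reindexing: layer distance `2` at spacing `h` is layer distance `1` at spacing `2h` -/

/-- `‖layerVec a h δ 2 i j‖ = ‖layerVec a (2h) δ 1 i j‖`: the vector to the point `(i, j)` of the
layer two spacings `h` above is the vector to the same point of the layer one spacing `2h` above.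
[folklore] -/
theorem j2neg_norm_layerVec_two (a h : ℝ) (δ i j : ℤ) :
    ‖layerVec a h δ 2 i j‖ = ‖layerVec a (2 * h) δ 1 i j‖ := by
  rw [norm_layerVec, norm_layerVec]
  congr 1
  push_cast
  ring

/-- Reindexing of the layer interaction: `layerInteraction V a h δ 2 = layerInteraction V a (2h) δ 1`.
[folklore] -/
theorem j2neg_layerInteraction_two (V : ℝ → ℝ) (a h : ℝ) (δ : ℤ) :
    layerInteraction V a h δ 2 = layerInteraction V a (2 * h) δ 1 := by
  unfold layerInteraction
  exact tsum_congr fun ij => by rw [j2neg_norm_layerVec_two]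

/-- Reindexing of the interlayer coupling: `J₂(a, h) = D_a(2h)`, i.e.
`barlowCoupling V a h 2 = barlowCoupling V a (2h) 1`. [folklore] -/
theorem j2neg_barlowCoupling_two (V : ℝ → ℝ) (a h : ℝ) :
    barlowCoupling V a h 2 = barlowCoupling V a (2 * h) 1 := by
  unfold barlowCoupling
  push_cast
  rw [j2neg_layerInteraction_two, j2neg_layerInteraction_two]

/-! ## The stub -/

/-- **Stub `stub_J2neg` of line `Sketch` (conjunct 2 of item 3063, with a uniform margin).** On the
box `47/50 ≤ a ≤ 1`, `39/50·a ≤ h ≤ 17/20·a` the second interlayer registry coupling of the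
Lennard-Jones potential is uniformly negative: `J₂(a, h) = barlowCoupling lennardJones a h 2 ≤ -c₀`
for some `c₀ > 0`.  From `LayeredHull.stub_registry` (`D_a(H) = barlowCoupling lennardJones a H 1` is
`≤ 0` and non-decreasing for `H ≥ 39a/25`, with corner gap `D_a(117a/50) - D_a(17a/10) ≥ c₀`) and the
reindexing `J₂(a, h) = D_a(2h)`, `2h ∈ [39a/25, 17a/10]`:
`J₂(a, h) = D_a(2h) ≤ D_a(17a/10) ≤ D_a(117a/50) - c₀ ≤ -c₀`. [folklore] -/
theorem stub_J2neg : ∃ c₀ : ℝ, 0 < c₀ ∧ ∀ a h : ℝ, 47 / 50 ≤ a → a ≤ 1 → 39 / 50 * a ≤ h → h ≤ 17 / 20 * a → Literature.MathematicalPhysics.StatisticalMechanics.barlowCoupling Literature.MathematicalPhysics.StatisticalMechanics.lennardJones a h 2 ≤ -c₀ := by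
  obtain ⟨c₀, hc₀, hreg⟩ := LayeredHull.stub_registry
  refine ⟨c₀, hc₀, fun a h ha ha1 hh hh1 => ?_⟩
  obtain ⟨hmono, hgap⟩ := hreg a ha ha1
  have hlo : 39 / 25 * a ≤ 2 * h := by linarith
  have hhi : 2 * h ≤ 17 / 10 * a := by linarith
  -- `D_a(2h) ≤ D_a(17a/10)` (monotonicity on `H ≥ 39a/25`).
  have hA := (hmono (2 * h) (17 / 10 * a) hlo hhi).2
  -- `D_a(117a/50) ≤ 0` (sign on `H ≥ 39a/25`; `117a/50 ≥ 39a/25` since `a > 0`).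
  have hB := (hmono (117 / 50 * a) (117 / 50 * a) (by linarith) le_rfl).1
  rw [j2neg_barlowCoupling_two]
  linarith

end Summit.AtomisticToContinuum.Crystallization.Theorems.PricedHcpWindowsJ2Neg
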